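import Summits.QuantumFields.BalabanUV.Beta.GAN24.ContactFaceJump
import Summits.QuantumFields.BalabanUV.Beta.GAN24.ContactGaugeStaircase

/-!
# `BalabanUV.Beta.GAN24.ContactFaceJumpStaircase` — binder row G-an2-4 / (CONV-C), CT-ROUTE, the row owner's `gen20/BORNSEC-PLAN-v1.md` §A (Λ-C)(C3) «[leaf-01∕02; S]», PART 2:
# **FOR A STAIRCASE GAUGE FUNCTION ONLY THE FACE JUMPS OF THE SCALES WHOSE FACE THE COARSE BOND CROSSES, PLUS THE FINEST PIECE, ENTER THE Λ CONTACT KERNEL** —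
# plan §0 (c2)(α)(β), and the instance at the route's bond gauge function (`ContactGaugeStaircase.gauge_eq_staircase`)

NOT IN PRINT; OUR BOOKKEEPING (G-an2-4 formalisation swarm → CRUX TEAM (2), leaf prover `b2b-balaban-gan24-formalise-leaf-01`, gen 60; INTENT «FACE-JUMP» journal
`CLAIMS.log` l.33586; names PROVISIONAL — the owner may rename ∕ re-cut).  [folklore] bookkeeping over PART 1 `ContactFaceJump` (two-block support, block-constant face jump),
the owner's `StaircaseFaces.blk_add_unitVec_of_not_dvd` ∕ `blk_one`, gan24-p2's `RespStepBmDecomp.blk_blk`, leaf-01 g58's `ContactGaugeStaircase.gauge_eq_staircase` ∕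
`abs_gaugePiece_le` BY NAME; 0 `def`, 0 cited facts, 0 `def … : Prop`, 0 sorry.  HONEST FRAMING (cell contract, verbatim): «discharging `BetaPertH` makes Bałaban's UV
stability UNCONDITIONAL — a real constructive-QFT result; it is NOT the continuum limit and NOT the Clay problem.»  HONEST DEPENDENCY (verbatim): «continuum YM on T⁴ ⇐
BetaPertH ∧ nine spine estimates (0/9 proved); BetaPertH ⇐ (D1) ∧ (D4) ∧ CAP+tail; G-an2-4 gates asym, D1 and NE2/3/4.»

## What (generic `d` unless marked; one step `L = Lc`, box root `ρ = toSite rr`)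
* §3 STAIRCASES `ψ u = Σ_{s<n+1} G s (blk (Lc^s) u)`: `staircase_split` (`ψ = G 0 + h₊ ∘ blk Lc`, `h₊ y′ = Σ_{s<n} G (s+1) (blk (Lc^s) y′)`),
  **`abs_weight_staircase_mul_linKerAt_le`** (`|w₄(ψ)·q¹| ≤ (|w₄(G 0)| + Σ_{s<n} |G (s+1) (blk (Lc^s) (y+e_μ)) − G (s+1) (blk (Lc^s) y)|)·|q¹|` for EVERY bond), the VANISHING of the
  `s`-th jump off the scale-`s` faces **`jump_eq_zero_of_not_dvd`** (`Lc^s ∤ y_μ + 1`), the indicator forms `abs_jump_le_ite` ∕ `abs_jump_le_ite_of_le` ∕ `sum_abs_jump_le`, and the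
  Λ-kernel summand bound `abs_coeff_mul_weight_mul_linKerAt_le` (the summand of leaf-02's `KΛ = −Σ_μ Σ'_y c·(w₄·q¹∕2)`), and the ΔΔ weight
  **`abs_weight_mul_dz_staircase_mul_linCountAt_le`** — four-site weight of one staircase × gradient of another on the support: the two coarse jump sums `J_a`, `J_b` pair only with the
  other function's FINEST piece, never with each other (the owner's plan v1.1 §0′ rebuttal, pointwise).
* §4 THE ROUTE'S INSTANCE: **`abs_weight_routeGauge_mul_linKerAt_le`** (generic `d`; the bond gauge function `Psi ρ Lc m n (delta1 μ₀ z₀) − bmGaugeAt ρ (B μ₀ z₀) Lc` of the dressed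
  composite leg, pieces explicit) and **`sum_abs_jump_routeGauge_le_three`** (`d = 3`, parametric in leaf-12's (N1) data as `abs_gaugePiece_le`: the jump sum is
  `≤ Σ_{s<n} [Lc^s ∣ y_μ+1]·2·(8·Lc·C·(Lc^{5(n+1)})⁻¹·Lc^{s+1})` — geometric letters on the CROSSED scales only).
USE ((C4), owner ∕ crux team): the face bonds of scale `s` have density `Lc^{−s}` among the coarse bonds (owner's (F2) `StaircaseFaces.tsum_ite_dvd_eq` pattern), so
`Σ_{(μ,y)} Σ_s [Lc^s ∣ y_μ+1]·Lc^{s+1} ≍ n·Lc·#bonds` — the ONE log of plan §0 (c), `(k−i)·Lc^{−(k−i)}` per lineage at `D = 4`.  Discharges NO slot letter; NO estimate of Bałaban's;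
0 wall binders; NEVER «G-an2-4 closed»; NOT D1, NOT BetaPertH, NOT continuum, NOT Clay.
-/

noncomputable section

open Finset
open scoped BigOperators
open Literature.MathematicalPhysics.QuantumFieldTheory
open Literature.MathematicalPhysics.QuantumFieldTheory.Balaban1983to89
open Literature.MathematicalPhysics.QuantumFieldTheory.Balaban1983to89.Beta
open AffineAveraging (Form0 Form1 Site box toSite unitVec unitVec_apply)
open AveragingContours (blk blk_block)
open AveragingHessianKernelsRooted (linCountAt linKerAt)
open Summit.QuantumFields.BalabanUV.Beta.GAN24.StaircaseFaces (blk_add_unitVec_of_not_dvd blk_one)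
open Summit.QuantumFields.BalabanUV.Beta.GAN24.RespStepBmDecomp (blk_blk)
open Summit.QuantumFields.BalabanUV.Beta.GAN24.ContactFaceJump (abs_weight_mul_linKerAt_le abs_weight_mul_linCountAt_le abs_dz_mul_linCountAt_le
  weight_mul_dz_mul_linCountAt_eq_zero)

namespace Summit.QuantumFields.BalabanUV.Beta.GAN24.ContactFaceJumpStaircase

variable {d : ℕ}

/-! ## §3 Staircases: only the face jumps of the scales whose face the coarse bond crosses, plus the finest piece, survive -/

section Staircase

variable {Lc : ℕ}

/-- [folklore] Nesting of the block labels along the tower: `blk (Lc^s) ∘ blk Lc = blk (Lc^(s+1))`. -/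
theorem blk_pow_blk (s : ℕ) (u : Site (d + 1)) : blk (Lc ^ s) (blk Lc u) = blk (Lc ^ (s + 1)) u := by
  rw [blk_blk, ← pow_succ']

/-- [folklore] **A STAIRCASE IS ITS FINEST PIECE PLUS ONE `Lc`-BLOCK-CONSTANT FUNCTION**: `Σ_{s<n+1} G s (blk (Lc^s) u) = G 0 u + h₊ (blk Lc u)`,
`h₊ y′ = Σ_{s<n} G (s+1) (blk (Lc^s) y′)`. -/
theorem staircase_split (G : ℕ → Site (d + 1) → ℝ) (n : ℕ) (u : Site (d + 1)) :
    ∑ s ∈ Finset.range (n + 1), G s (blk (Lc ^ s) u) = G 0 u + ∑ s ∈ Finset.range n, G (s + 1) (blk (Lc ^ s) (blk Lc u)) := by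
  rw [Finset.sum_range_succ', pow_zero, blk_one, add_comm]
  simp only [blk_pow_blk]

/-- NOT IN PRINT; OUR BOOKKEEPING.  **THE FOUR-SITE WEIGHT OF A STAIRCASE GAUGE FUNCTION ON THE SUPPORT OF `q¹,ρ`: THE FINEST PIECE PLUS THE FACE JUMPS** (one step
`L = Lc`, box root, EVERY bond `(b,z)`, any pieces `G`):
`|w₄(ψ; b,z; μ,y)·q¹| ≤ (|w₄(G 0; b,z; μ,y)| + Σ_{s<n} |G (s+1) (blk (Lc^s) (y+e_μ)) − G (s+1) (blk (Lc^s) y)|)·|q¹|`. -/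
theorem abs_weight_staircase_mul_linKerAt_le (hLc : 1 ≤ Lc) {r : Fin (d + 1) → ℕ} (hr : r ∈ box (d + 1) Lc) (G : ℕ → Site (d + 1) → ℝ) (n : ℕ)
    {ψ : Site (d + 1) → ℝ} (hψ : ∀ u, ψ u = ∑ s ∈ Finset.range (n + 1), G s (blk (Lc ^ s) u))
    (μ : Fin (d + 1)) (y : Site (d + 1)) (b : Fin (d + 1)) (z : Site (d + 1)) :
    |(ψ z + ψ (z + unitVec b) - ψ ((Lc : ℤ) • y + toSite r) - ψ ((Lc : ℤ) • y + toSite r + (Lc : ℤ) • unitVec μ)) * linKerAt (toSite r) Lc μ y (b, z)|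
      ≤ (|G 0 z + G 0 (z + unitVec b) - G 0 ((Lc : ℤ) • y + toSite r) - G 0 ((Lc : ℤ) • y + toSite r + (Lc : ℤ) • unitVec μ)|
          + ∑ s ∈ Finset.range n, |G (s + 1) (blk (Lc ^ s) (y + unitVec μ)) - G (s + 1) (blk (Lc ^ s) y)|)
        * |linKerAt (toSite r) Lc μ y (b, z)| := by
  set q := linKerAt (toSite r) Lc μ y (b, z) with hq
  set hp : Site (d + 1) → ℝ := fun y' => ∑ s ∈ Finset.range n, G (s + 1) (blk (Lc ^ s) y') with hhp
  have hψ' : ∀ u, ψ u = G 0 u + hp (blk Lc u) := fun u => by rw [hψ, staircase_split]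
  -- split the weight: finest piece + block-constant part
  have e : (ψ z + ψ (z + unitVec b) - ψ ((Lc : ℤ) • y + toSite r) - ψ ((Lc : ℤ) • y + toSite r + (Lc : ℤ) • unitVec μ)) * q
      = (G 0 z + G 0 (z + unitVec b) - G 0 ((Lc : ℤ) • y + toSite r) - G 0 ((Lc : ℤ) • y + toSite r + (Lc : ℤ) • unitVec μ)) * q
        + ((fun u => hp (blk Lc u)) z + (fun u => hp (blk Lc u)) (z + unitVec b) - (fun u => hp (blk Lc u)) ((Lc : ℤ) • y + toSite r)
            - (fun u => hp (blk Lc u)) ((Lc : ℤ) • y + toSite r + (Lc : ℤ) • unitVec μ)) * q := by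
    simp only [hψ']; ring
  rw [e, add_mul]
  refine (abs_add_le _ _).trans (add_le_add (le_of_eq (abs_mul _ _)) ?_)
  refine (abs_weight_mul_linKerAt_le hLc hr hp (fun u => rfl) μ y b z).trans (mul_le_mul_of_nonneg_right ?_ (abs_nonneg _))
  rw [hhp]
  simp only [← Finset.sum_sub_distrib]
  exact Finset.abs_sum_le_sum_abs _ _

/-- [folklore] The jump of the block-constant part `h₊` of a staircase across the coarse bond is at most the sum of the per-scale jumps. -/
theorem abs_hplus_jump_le (G : ℕ → Site (d + 1) → ℝ) (n : ℕ) (μ : Fin (d + 1)) (y : Site (d + 1)) :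
    |(∑ s ∈ Finset.range n, G (s + 1) (blk (Lc ^ s) (y + unitVec μ))) - ∑ s ∈ Finset.range n, G (s + 1) (blk (Lc ^ s) y)|
      ≤ ∑ s ∈ Finset.range n, |G (s + 1) (blk (Lc ^ s) (y + unitVec μ)) - G (s + 1) (blk (Lc ^ s) y)| := by
  rw [← Finset.sum_sub_distrib]
  exact Finset.abs_sum_le_sum_abs _ _

/-- NOT IN PRINT; OUR BOOKKEEPING.  **THE ΔΔ WEIGHT: THE FOUR-SITE WEIGHT OF ONE STAIRCASE TIMES THE GRADIENT OF ANOTHER, ON THE SUPPORT OF `q¹,ρ` — THE TWO COARSE JUMPS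
NEVER MULTIPLY** (the row owner's plan v1.1 §0′ rebuttal as a pointwise bound; one step `L = Lc`, box root, EVERY bond `(b,z)`, any pieces `Ga`, `Gb`):
`|w₄(ψ_a; b,z; μ,y)·(ψ_b(z+e_b) − ψ_b z)·linCountAt| ≤ (|w₄(Ga 0)|·(|Gb 0 (z+e_b) − Gb 0 z| + J_b) + J_a·|Gb 0 (z+e_b) − Gb 0 z|)·|linCountAt|`, `J = Σ_{s<n} |jump_s(μ,y)|` — the finest
pieces pair with everything, the coarse jumps `J_a`, `J_b` only with the other function's FINEST piece. -/
theorem abs_weight_mul_dz_staircase_mul_linCountAt_le (hLc : 1 ≤ Lc) {r : Fin (d + 1) → ℕ} (hr : r ∈ box (d + 1) Lc) (Ga Gb : ℕ → Site (d + 1) → ℝ) (na nb : ℕ)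
    {ψa ψb : Site (d + 1) → ℝ} (hψa : ∀ u, ψa u = ∑ s ∈ Finset.range (na + 1), Ga s (blk (Lc ^ s) u))
    (hψb : ∀ u, ψb u = ∑ s ∈ Finset.range (nb + 1), Gb s (blk (Lc ^ s) u))
    (μ : Fin (d + 1)) (y : Site (d + 1)) (b : Fin (d + 1)) (z : Site (d + 1)) :
    |(ψa z + ψa (z + unitVec b) - ψa ((Lc : ℤ) • y + toSite r) - ψa ((Lc : ℤ) • y + toSite r + (Lc : ℤ) • unitVec μ))
        * (ψb (z + unitVec b) - ψb z) * (linCountAt (toSite r) Lc μ y (b, z) : ℝ)|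
      ≤ (|Ga 0 z + Ga 0 (z + unitVec b) - Ga 0 ((Lc : ℤ) • y + toSite r) - Ga 0 ((Lc : ℤ) • y + toSite r + (Lc : ℤ) • unitVec μ)|
            * (|Gb 0 (z + unitVec b) - Gb 0 z| + ∑ s ∈ Finset.range nb, |Gb (s + 1) (blk (Lc ^ s) (y + unitVec μ)) - Gb (s + 1) (blk (Lc ^ s) y)|)
          + (∑ s ∈ Finset.range na, |Ga (s + 1) (blk (Lc ^ s) (y + unitVec μ)) - Ga (s + 1) (blk (Lc ^ s) y)|) * |Gb 0 (z + unitVec b) - Gb 0 z|)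
        * |(linCountAt (toSite r) Lc μ y (b, z) : ℝ)| := by
  set q : ℝ := (linCountAt (toSite r) Lc μ y (b, z) : ℝ) with hq
  set hpa : Site (d + 1) → ℝ := fun y' => ∑ s ∈ Finset.range na, Ga (s + 1) (blk (Lc ^ s) y') with hhpa
  set hpb : Site (d + 1) → ℝ := fun y' => ∑ s ∈ Finset.range nb, Gb (s + 1) (blk (Lc ^ s) y') with hhpb
  have hψa' : ∀ u, ψa u = Ga 0 u + hpa (blk Lc u) := fun u => by rw [hψa, staircase_split]
  have hψb' : ∀ u, ψb u = Gb 0 u + hpb (blk Lc u) := fun u => by rw [hψb, staircase_split]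
  -- the four pieces
  set A0 : ℝ := Ga 0 z + Ga 0 (z + unitVec b) - Ga 0 ((Lc : ℤ) • y + toSite r) - Ga 0 ((Lc : ℤ) • y + toSite r + (Lc : ℤ) • unitVec μ) with hA0
  set A1 : ℝ := hpa (blk Lc z) + hpa (blk Lc (z + unitVec b)) - hpa (blk Lc ((Lc : ℤ) • y + toSite r))
    - hpa (blk Lc ((Lc : ℤ) • y + toSite r + (Lc : ℤ) • unitVec μ)) with hA1
  set B0 : ℝ := Gb 0 (z + unitVec b) - Gb 0 z with hB0
  set B1 : ℝ := hpb (blk Lc (z + unitVec b)) - hpb (blk Lc z) with hB1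
  set Ja : ℝ := ∑ s ∈ Finset.range na, |Ga (s + 1) (blk (Lc ^ s) (y + unitVec μ)) - Ga (s + 1) (blk (Lc ^ s) y)| with hJa
  set Jb : ℝ := ∑ s ∈ Finset.range nb, |Gb (s + 1) (blk (Lc ^ s) (y + unitVec μ)) - Gb (s + 1) (blk (Lc ^ s) y)| with hJb
  have e : (ψa z + ψa (z + unitVec b) - ψa ((Lc : ℤ) • y + toSite r) - ψa ((Lc : ℤ) • y + toSite r + (Lc : ℤ) • unitVec μ))
        * (ψb (z + unitVec b) - ψb z) * q
      = A0 * B0 * q + A0 * (B1 * q) + B0 * (A1 * q) + A1 * B1 * q := by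
    simp only [hψa', hψb', hA0, hA1, hB0, hB1]; ring
  -- the ΔΔ piece vanishes, the mixed pieces carry ONE coarse jump each
  have h11 : A1 * B1 * q = 0 :=
    weight_mul_dz_mul_linCountAt_eq_zero hLc hr (ψa := fun u => hpa (blk Lc u)) (ψb := fun u => hpb (blk Lc u)) hpa hpb
      (fun _ => rfl) (fun _ => rfl) μ y b z
  have h1q : |A1 * q| ≤ Ja * |q| :=
    (abs_weight_mul_linCountAt_le hLc hr (ψ := fun u => hpa (blk Lc u)) hpa (fun _ => rfl) μ y b z).trans
      (mul_le_mul_of_nonneg_right (by rw [hhpa]; exact abs_hplus_jump_le Ga na μ y) (abs_nonneg _))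
  have hB1q : |B1 * q| ≤ Jb * |q| :=
    (abs_dz_mul_linCountAt_le hLc hr (ψ := fun u => hpb (blk Lc u)) hpb (fun _ => rfl) μ y b z).trans
      (mul_le_mul_of_nonneg_right (by rw [hhpb]; exact abs_hplus_jump_le Gb nb μ y) (abs_nonneg _))
  rw [e, h11, add_zero]
  calc |A0 * B0 * q + A0 * (B1 * q) + B0 * (A1 * q)|
      ≤ |A0 * B0 * q| + |A0 * (B1 * q)| + |B0 * (A1 * q)| := abs_add_three _ _ _
    _ = |A0| * |B0| * |q| + |A0| * |B1 * q| + |B0| * |A1 * q| := by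
        have e1 : |A0 * B0 * q| = |A0| * |B0| * |q| := by rw [abs_mul, abs_mul]
        rw [e1, abs_mul A0 (B1 * q), abs_mul B0 (A1 * q)]
    _ ≤ |A0| * |B0| * |q| + |A0| * (Jb * |q|) + |B0| * (Ja * |q|) := by
        gcongr
    _ = (|A0| * (|B0| + Jb) + Ja * |B0|) * |q| := by ring

/-- NOT IN PRINT; OUR BOOKKEEPING.  **THE JUMP OF THE SCALE-`(s+1)` PIECE ACROSS THE COARSE BOND `(μ,y)` VANISHES UNLESS THE BOND CROSSES A FACE OF SCALE `s`**
(`Lc^s ∤ y_μ + 1`; the owner's (F1) `blk_add_unitVec_of_not_dvd`). -/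
theorem jump_eq_zero_of_not_dvd (hLc : 1 ≤ Lc) (G : ℕ → Site (d + 1) → ℝ) (s : ℕ) {μ : Fin (d + 1)} {y : Site (d + 1)}
    (h : ¬ ((Lc : ℤ) ^ s ∣ y μ + 1)) : G (s + 1) (blk (Lc ^ s) (y + unitVec μ)) - G (s + 1) (blk (Lc ^ s) y) = 0 := by
  have h' : ¬ (((Lc ^ s : ℕ) : ℤ) ∣ y μ + 1) := by rwa [Nat.cast_pow]
  rw [blk_add_unitVec_of_not_dvd (Nat.one_le_pow _ _ hLc) h', sub_self]

/-- [folklore] Indicator form: `|jump_s| ≤ [Lc^s ∣ y_μ+1]·|jump_s|`. -/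
theorem abs_jump_le_ite (hLc : 1 ≤ Lc) (G : ℕ → Site (d + 1) → ℝ) (s : ℕ) (μ : Fin (d + 1)) (y : Site (d + 1)) :
    |G (s + 1) (blk (Lc ^ s) (y + unitVec μ)) - G (s + 1) (blk (Lc ^ s) y)|
      ≤ if (Lc : ℤ) ^ s ∣ y μ + 1 then |G (s + 1) (blk (Lc ^ s) (y + unitVec μ)) - G (s + 1) (blk (Lc ^ s) y)| else 0 := by
  split_ifs with h
  · exact le_rfl
  · rw [jump_eq_zero_of_not_dvd hLc G s h, abs_zero]

/-- [folklore] With per-scale sup letters `|G (s+1) y′| ≤ a (s+1)` the jump is at most `[Lc^s ∣ y_μ+1]·2·a (s+1)`. -/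
theorem abs_jump_le_ite_of_le (hLc : 1 ≤ Lc) (G : ℕ → Site (d + 1) → ℝ) {a : ℕ → ℝ} (s : ℕ) (ha : ∀ y', |G (s + 1) y'| ≤ a (s + 1))
    (μ : Fin (d + 1)) (y : Site (d + 1)) :
    |G (s + 1) (blk (Lc ^ s) (y + unitVec μ)) - G (s + 1) (blk (Lc ^ s) y)| ≤ if (Lc : ℤ) ^ s ∣ y μ + 1 then 2 * a (s + 1) else 0 := by
  refine (abs_jump_le_ite hLc G s μ y).trans ?_
  split_ifs with h
  · exact (abs_sub _ _).trans (by linarith [ha (blk (Lc ^ s) (y + unitVec μ)), ha (blk (Lc ^ s) y)])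
  · exact le_rfl

/-- NOT IN PRINT; OUR BOOKKEEPING.  **THE SUM OF THE FACE JUMPS IS CARRIED BY THE CROSSED SCALES ONLY**:
`Σ_{s<n} |jump_s| ≤ Σ_{s<n} [Lc^s ∣ y_μ+1]·2·a (s+1)`. -/
theorem sum_abs_jump_le (hLc : 1 ≤ Lc) (G : ℕ → Site (d + 1) → ℝ) {a : ℕ → ℝ} (n : ℕ) (ha : ∀ s y', s < n → |G (s + 1) y'| ≤ a (s + 1))
    (μ : Fin (d + 1)) (y : Site (d + 1)) :
    ∑ s ∈ Finset.range n, |G (s + 1) (blk (Lc ^ s) (y + unitVec μ)) - G (s + 1) (blk (Lc ^ s) y)|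
      ≤ ∑ s ∈ Finset.range n, (if (Lc : ℤ) ^ s ∣ y μ + 1 then 2 * a (s + 1) else 0) :=
  Finset.sum_le_sum fun s hs => abs_jump_le_ite_of_le hLc G s (fun y' => ha s y' (Finset.mem_range.1 hs)) μ y

/-- NOT IN PRINT; OUR BOOKKEEPING.  **THE Λ-KERNEL SUMMAND WITH THE FACE LETTER** (the summand of leaf-02's `KΛ(ψ; κ,u; b,z) = −Σ_μ Σ'_y c μ y κ u·(w₄·q¹∕2)` for a staircase
`ψ`): `|c μ y κ u·(w₄(ψ; b,z; μ,y)·q¹,ρ_{(μ,y)}(b,z)∕2)| ≤ |c μ y κ u|·((|w₄(G 0; b,z; μ,y)| + Σ_{s<n} |jump_s (μ,y)|)·|q¹,ρ_{(μ,y)}(b,z)|∕2)`. -/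
theorem abs_coeff_mul_weight_mul_linKerAt_le (hLc : 1 ≤ Lc) {r : Fin (d + 1) → ℕ} (hr : r ∈ box (d + 1) Lc) (G : ℕ → Site (d + 1) → ℝ) (n : ℕ)
    {ψ : Site (d + 1) → ℝ} (hψ : ∀ u, ψ u = ∑ s ∈ Finset.range (n + 1), G s (blk (Lc ^ s) u))
    (c : ℝ) (μ : Fin (d + 1)) (y : Site (d + 1)) (b : Fin (d + 1)) (z : Site (d + 1)) :
    |c * ((ψ z + ψ (z + unitVec b) - ψ ((Lc : ℤ) • y + toSite r) - ψ ((Lc : ℤ) • y + toSite r + (Lc : ℤ) • unitVec μ))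
        * linKerAt (toSite r) Lc μ y (b, z) / 2)|
      ≤ |c| * ((|G 0 z + G 0 (z + unitVec b) - G 0 ((Lc : ℤ) • y + toSite r) - G 0 ((Lc : ℤ) • y + toSite r + (Lc : ℤ) • unitVec μ)|
          + ∑ s ∈ Finset.range n, |G (s + 1) (blk (Lc ^ s) (y + unitVec μ)) - G (s + 1) (blk (Lc ^ s) y)|)
        * |linKerAt (toSite r) Lc μ y (b, z)| / 2) := by
  rw [abs_mul, abs_div, abs_two]
  exact mul_le_mul_of_nonneg_left (div_le_div_of_nonneg_right (abs_weight_staircase_mul_linKerAt_le hLc hr G n hψ μ y b z) zero_le_two) (abs_nonneg _)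

end Staircase

/-! ## §4 The route's instance: the bond gauge function of the dressed composite leg (`ContactGaugeStaircase.gauge_eq_staircase`) -/

section Route

variable {Lc : ℕ} [NeZero Lc]

open KKTFluctuationKernel (delta1)
open BalabanCompositeJets (respStep)
open B4ContourShift (supNorm supNorm_nonneg)
open Literature.MathematicalPhysics.QuantumFieldTheory.LatticeForm (quo)
open Summit.QuantumFields.BalabanUV.Beta.AxialProjectorBlockMean (bmGaugeAt)
open Summit.QuantumFields.BalabanUV.Beta.GAN24.RespStepBmDecompLegs (legAct)
open Summit.QuantumFields.BalabanUV.Beta.GAN24.RespStepBmDecompPsi (Psi)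
open Summit.QuantumFields.BalabanUV.Beta.GAN24.ContactGaugeStaircase (gauge_eq_staircase abs_gaugePiece_le)

/-- NOT IN PRINT; OUR BOOKKEEPING.  **THE FOUR-SITE WEIGHT OF THE ROUTE'S BOND GAUGE FUNCTION `λ_{μ₀z₀} = Psi ρ Lc m n (delta1 μ₀ z₀) − bmGaugeAt ρ (B μ₀ z₀) Lc`
ON THE SUPPORT OF `q¹,ρ`** (generic `d`, box root, every source bond `(μ₀,z₀)`, every coarse bond `(μ,y)` of the step `m → m+1`, EVERY fine bond `(b,z)`): the finest piece
(the rooted block-mean gauge of the undressed column `B = respStep (Lc^m) (Lc^(m+n+1))` itself) + the face jumps of the transported gauges of the intermediate columns. -/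
theorem abs_weight_routeGauge_mul_linKerAt_le {rr : Fin (d + 1) → ℕ} (hrr : rr ∈ box (d + 1) Lc) (m n : ℕ) (μ₀ : Fin (d + 1)) (z₀ : Site (d + 1))
    (μ : Fin (d + 1)) (y : Site (d + 1)) (b : Fin (d + 1)) (z : Site (d + 1)) :
    |((Psi (toSite rr) Lc m n (delta1 μ₀ z₀) - bmGaugeAt (toSite rr) (respStep (d := d) (Lc ^ m) (Lc ^ (m + n + 1)) μ₀ z₀) Lc) z
        + (Psi (toSite rr) Lc m n (delta1 μ₀ z₀) - bmGaugeAt (toSite rr) (respStep (d := d) (Lc ^ m) (Lc ^ (m + n + 1)) μ₀ z₀) Lc) (z + unitVec b)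
        - (Psi (toSite rr) Lc m n (delta1 μ₀ z₀) - bmGaugeAt (toSite rr) (respStep (d := d) (Lc ^ m) (Lc ^ (m + n + 1)) μ₀ z₀) Lc) ((Lc : ℤ) • y + toSite rr)
        - (Psi (toSite rr) Lc m n (delta1 μ₀ z₀) - bmGaugeAt (toSite rr) (respStep (d := d) (Lc ^ m) (Lc ^ (m + n + 1)) μ₀ z₀) Lc)
            ((Lc : ℤ) • y + toSite rr + (Lc : ℤ) • unitVec μ))
        * linKerAt (toSite rr) Lc μ y (b, z)|
      ≤ (|-bmGaugeAt (toSite rr) (respStep (d := d) (Lc ^ m) (Lc ^ (m + n + 1)) μ₀ z₀) Lc z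
            + -bmGaugeAt (toSite rr) (respStep (d := d) (Lc ^ m) (Lc ^ (m + n + 1)) μ₀ z₀) Lc (z + unitVec b)
            - -bmGaugeAt (toSite rr) (respStep (d := d) (Lc ^ m) (Lc ^ (m + n + 1)) μ₀ z₀) Lc ((Lc : ℤ) • y + toSite rr)
            - -bmGaugeAt (toSite rr) (respStep (d := d) (Lc ^ m) (Lc ^ (m + n + 1)) μ₀ z₀) Lc ((Lc : ℤ) • y + toSite rr + (Lc : ℤ) • unitVec μ)|
          + ∑ s ∈ Finset.range n,
              |-(((Lc : ℝ) ^ ((d + 1) * (s + 1)))⁻¹ *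
                  bmGaugeAt (toSite rr) (legAct (respStep (d := d) (Lc ^ (m + (s + 1))) (Lc ^ (m + n + 1))) (delta1 μ₀ z₀)) Lc (blk (Lc ^ s) (y + unitVec μ)))
               - -(((Lc : ℝ) ^ ((d + 1) * (s + 1)))⁻¹ *
                  bmGaugeAt (toSite rr) (legAct (respStep (d := d) (Lc ^ (m + (s + 1))) (Lc ^ (m + n + 1))) (delta1 μ₀ z₀)) Lc (blk (Lc ^ s) y))|)
        * |linKerAt (toSite rr) Lc μ y (b, z)| := by
  have hLc : 1 ≤ Lc := Nat.one_le_iff_ne_zero.2 (NeZero.ne Lc)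
  have h := abs_weight_staircase_mul_linKerAt_le hLc hrr
    (fun (s : ℕ) (y' : Site (d + 1)) =>
      if s = 0 then -bmGaugeAt (toSite rr) (respStep (d := d) (Lc ^ m) (Lc ^ (m + n + 1)) μ₀ z₀) Lc y'
      else -(((Lc : ℝ) ^ ((d + 1) * s))⁻¹ *
        bmGaugeAt (toSite rr) (legAct (respStep (d := d) (Lc ^ (m + s)) (Lc ^ (m + n + 1))) (delta1 μ₀ z₀)) Lc y')) n
    (ψ := Psi (toSite rr) Lc m n (delta1 μ₀ z₀) - bmGaugeAt (toSite rr) (respStep (d := d) (Lc ^ m) (Lc ^ (m + n + 1)) μ₀ z₀) Lc)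
    (fun u => by rw [Pi.sub_apply]; exact gauge_eq_staircase (Lc := Lc) (toSite rr) m n μ₀ z₀ u) μ y b z
  simp only [Nat.succ_ne_zero, if_false, if_true] at h
  simpa only [Nat.add_assoc] using h

/-- NOT IN PRINT; OUR BOOKKEEPING.  **`d = 3`: THE FACE JUMPS OF THE ROUTE'S GAUGE FUNCTION CARRY GEOMETRIC LETTERS ON THE CROSSED SCALES ONLY** (in-block root;
parametric in leaf-12's (N1) data `κ₀, C` exactly as `ContactGaugeStaircase.abs_gaugePiece_le`; the block-scale envelope dropped to `1`):
`Σ_{s<n} |jump_s(μ,y)| ≤ Σ_{s<n} [Lc^s ∣ y_μ+1]·2·(8·Lc·C·(Lc^{5(n+1)})⁻¹·Lc^{s+1})` — against the crude `(n+1)`-fold sum of all the letters. -/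
theorem sum_abs_jump_routeGauge_le_three {κ₀ C : ℝ} (hκ₀ : 0 ≤ κ₀)
    (hN1 : ∀ (m k : ℕ) (μ : Fin (3 + 1)) (z : Site (3 + 1)) (l'' : Fin (3 + 1)) (w' : Site (3 + 1)),
      |respStep (d := 3) (Lc ^ m) (Lc ^ (m + k + 1)) μ z l'' w'| ≤
        C * ((Lc : ℝ) ^ (5 * (k + 1)))⁻¹ * Real.exp (-(κ₀ * supNorm (quo (Lc ^ (k + 1)) w' - z))))
    {rr : Fin (3 + 1) → ℕ} (hrr : rr ∈ box (3 + 1) Lc) (m n : ℕ) (μ₀ : Fin (3 + 1)) (z₀ : Site (3 + 1)) (μ : Fin (3 + 1)) (y : Site (3 + 1)) :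
    ∑ s ∈ Finset.range n,
        |-(((Lc : ℝ) ^ ((3 + 1) * (s + 1)))⁻¹ *
            bmGaugeAt (toSite rr) (legAct (respStep (d := 3) (Lc ^ (m + (s + 1))) (Lc ^ (m + n + 1))) (delta1 μ₀ z₀)) Lc (blk (Lc ^ s) (y + unitVec μ)))
         - -(((Lc : ℝ) ^ ((3 + 1) * (s + 1)))⁻¹ *
            bmGaugeAt (toSite rr) (legAct (respStep (d := 3) (Lc ^ (m + (s + 1))) (Lc ^ (m + n + 1))) (delta1 μ₀ z₀)) Lc (blk (Lc ^ s) y))|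
      ≤ ∑ s ∈ Finset.range n,
          (if (Lc : ℤ) ^ s ∣ y μ + 1 then 2 * (8 * (Lc : ℝ) * C * ((Lc : ℝ) ^ (5 * (n + 1)))⁻¹ * (Lc : ℝ) ^ (s + 1)) else 0) := by
  have hLc : 1 ≤ Lc := Nat.one_le_iff_ne_zero.2 (NeZero.ne Lc)
  -- the piece family of `gauge_eq_staircase` and its sup letters (envelope ≤ 1, every label is a block label)
  have key := sum_abs_jump_le (d := 3) hLc
    (fun (s : ℕ) (y' : Site (3 + 1)) =>
      if s = 0 then -bmGaugeAt (toSite rr) (respStep (d := 3) (Lc ^ m) (Lc ^ (m + n + 1)) μ₀ z₀) Lc y'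
      else -(((Lc : ℝ) ^ ((3 + 1) * s))⁻¹ *
        bmGaugeAt (toSite rr) (legAct (respStep (d := 3) (Lc ^ (m + s)) (Lc ^ (m + n + 1))) (delta1 μ₀ z₀)) Lc y'))
    (a := fun s => 8 * (Lc : ℝ) * C * ((Lc : ℝ) ^ (5 * (n + 1)))⁻¹ * (Lc : ℝ) ^ s) n ?_ μ y
  · simp only [Nat.succ_ne_zero, if_false] at key
    simpa only [Nat.add_assoc] using key
  · intro s y' hs
    -- every coarse label is the label of a fine point: `y' = blk (Lc^(s+1)) (Lc^(s+1) • y')`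
    have h0 : (fun _ : Fin (3 + 1) => (0 : ℕ)) ∈ box (3 + 1) (Lc ^ (s + 1)) := by
      have : 0 < Lc ^ (s + 1) := Nat.one_le_pow _ _ hLc
      simpa [AffineAveraging.box, Fintype.mem_piFinset, Finset.mem_range] using this
    have hy' : y' = blk (Lc ^ (s + 1)) (((Lc ^ (s + 1) : ℕ) : ℤ) • y' + toSite (fun _ : Fin (3 + 1) => (0 : ℕ))) := by
      rw [blk_block y' h0]
    have h := abs_gaugePiece_le hN1 hrr m n μ₀ z₀ (s := s + 1) (by omega) (((Lc ^ (s + 1) : ℕ) : ℤ) • y' + toSite (fun _ : Fin (3 + 1) => (0 : ℕ)))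
    rw [← hy'] at h
    refine h.trans ?_
    have hα : 0 ≤ 8 * (Lc : ℝ) * C * ((Lc : ℝ) ^ (5 * (n + 1)))⁻¹ * (Lc : ℝ) ^ (s + 1) := by
      have hC : 0 ≤ C := by
        have h0 := hN1 0 0 0 0 0 0
        have : 0 ≤ C * ((Lc : ℝ) ^ (5 * (0 + 1)))⁻¹ * Real.exp (-(κ₀ * supNorm (quo (Lc ^ (0 + 1)) (0 : Site (3 + 1)) - 0))) :=
          (abs_nonneg _).trans h0
        have hpos : 0 < ((Lc : ℝ) ^ (5 * (0 + 1)))⁻¹ * Real.exp (-(κ₀ * supNorm (quo (Lc ^ (0 + 1)) (0 : Site (3 + 1)) - 0))) := by positivity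
        nlinarith
      positivity
    calc 8 * (Lc : ℝ) * C * ((Lc : ℝ) ^ (5 * (n + 1)))⁻¹ * (Lc : ℝ) ^ (s + 1) *
          Real.exp (-(κ₀ * supNorm (quo (Lc ^ (n + 1)) (((Lc ^ (s + 1) : ℕ) : ℤ) • y' + toSite (fun _ : Fin (3 + 1) => (0 : ℕ))) - z₀)))
        ≤ 8 * (Lc : ℝ) * C * ((Lc : ℝ) ^ (5 * (n + 1)))⁻¹ * (Lc : ℝ) ^ (s + 1) * 1 :=
          mul_le_mul_of_nonneg_left (Real.exp_le_one_iff.2 (by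
            have := supNorm_nonneg (quo (Lc ^ (n + 1)) (((Lc ^ (s + 1) : ℕ) : ℤ) • y' + toSite (fun _ : Fin (3 + 1) => (0 : ℕ))) - z₀)
            nlinarith)) hα
      _ = 8 * (Lc : ℝ) * C * ((Lc : ℝ) ^ (5 * (n + 1)))⁻¹ * (Lc : ℝ) ^ (s + 1) := mul_one _

end Route

end Summit.QuantumFields.BalabanUV.Beta.GAN24.ContactFaceJumpStaircase

end
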